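import Literature.MathematicalPhysics.QuantumFieldTheory.Balaban1983to89.B6BlockHolderCalculus
import Literature.MathematicalPhysics.QuantumFieldTheory.Balaban1983to89.B6BlockDecayGradFactorsV1

/-!
# `Balaban1983to89.B6BlockHolderGEV1` — T. Bałaban, *Propagators and renormalization transformations for lattice gauge theories. II*,
# Commun. Math. Phys. **96** (1984) 223–250 [Balaban1984PropagatorsII], Proposition 2.5 p. 246: THE HÖLDER-IN-THE-OUTPUT (PAIR) BOUND OF THE FIRST
# FACTOR `∇_λG^{(w′)}` of `∇G̃_j = ∇G^{(w′)} − ∇H_jQ_jG^{(w′)}` in (2.129) for `tsV1`, i.e. [4] PROPOSITION 1.2 (1.111), MEMBER `‖ζ∇GJ‖_α`, FOR `G_k = Δ_a⁻¹`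
# BY NAME, read as a kernel pair bound — file H3b of the (1.111) members of the two-level decay programme

statement-level skeleton of published theorems with citation tags; proofs where landed; nothing here is a claim about the Yang–Mills mass gap

PDF held: `paper:balaban1984-cmp96-propagators-rt-ii` (journal page = PDF page + 222), p. 246 [PDF 24]; `paper:balaban1984-cmp95-propagators-rt-i` ([4],
journal page = PDF page + 16), p. 35 [PDF 19] (text layers grepped this session).  PRINT.  [4] p. 35 (verbatim, as quoted in the tree's `B5.Prop12Printed`):
*"‖ζ∇GJ‖_α, ‖ζG∇*J‖_α ≤ O(1)e^{−δ₀|y−y′|}(‖ζ‖_α + |ζ|)|J| (1.111) for 0 ≤ α < 1, ζ ∈ C₀^∞(Δ̃(y)), supp J ⊂ Δ̃(y′), with the constant O(1) depending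
on d and α (O(1) → ∞ if α → 1)"*; [B6] p. 246: *"From these representations we obtain all the necessary properties of the operators H_j, G̃_j. They
follow from the Proposition 1.2 …"*.

CITATION HEADER (lean-in-tree rule) — WHAT IS REPRODUCED.  Phase-2 file of the `lit-balaban` typed skeleton (HOME `run/shared/lean/pub/lit-balaban/`),
seat **p38 gen 21** (B6 fold owner r03, referee ref-4), FILE H3b of the (1.111) members of seat p22's Prop. 2.5 two-level decay programme (H1
`…B6BlockHolderCalculus`, H2 `…B6BlockHolderLipschitzV1`, H3a `…B6BlockHolderHjV1`); SKELETON rows **B6.Prop2.5** / **B6.Eq2.131** and [4] **B5.Prop1.2**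
(cells only; decls of record untouched).  **`holderBound_DGE_scaling`**: for every `d + 1`, `L`, `a > 0` there is `δ₀ > 0` (of [4] Prop. 1.2, INDEPENDENT
OF `α`) and for every `0 ≤ α < 1` a `C_α ≥ 0` such that for every volume, `j ≤ m + K`, direction `λ`, fine bonds `b₁ = ⟨x, ν⟩`, `b₂ = ⟨x′, ν⟩` with
`|x − x′|_∞ ≤ n = L^j` and unit site `y`: `Σ_{b₀′ : y(b₀′₋) = y}|(D_λG^{(w′)})(e_{b₀′})_{b₁} − (D_λG^{(w′)})(e_{b₀′})_{b₂}| ≤ C_α·(|x − x′|_∞/n)^α·e^{−δ₀|y(x) − y|_T}`,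
`G^{(w′)} = GE` at the weight `w′ = a·n^{d+1}` (p22's file 6/8 reading of [4]'s `Δ_a⁻¹`).  ROUTE = [BalabanImbrieJaffe1985] (7.2.2)'s (tree: p09's
`…BIJ85Ineq722ProofPart2.gradH_holder_small/_large`, here for `∇G` itself instead of `∇GQ*(QGQ*)⁻¹`): p19's HYPOTHESIS-FREE [4] Prop. 1.2 for all tori
(`…BIJ85Prop12AllTori.prop12Printed_allTori_allScales` → `prop12Hyps_of_ineq110_114`: members `e110_1`, `h111` on `torusRep P j (deltaAData j a)`),
p09's cut-offs of the torus (`cutoffHyps_torus`: for `|x − x′| ≤ ¼` a `ζ ∈ C₀^∞(Δ̃(y_x))`, `ζ(x) = ζ(x′) = 1`, `|ζ| ≤ 1`, `‖ζ‖_α ≤ 4`): CLOSE PAIRS by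
(1.111) with that `ζ` on test vectors supported in one block (H1's `holderBound_of_cubeSup`), FAR PAIRS (`¼ < |x − x′| ≤ 1`) by (1.110)₁ twice
(H1's `holderBound_of_blockBound`, `|x − x′|^{−α} ≤ 4`); the identification `(D_λG^{(w′)}x)(b₀) = (∇G_kJ)(b₀₋, λ, ν)` with p09's kernel `DGk` is
p22's (file 8 §5, r03's `GE_apply_eq_sum_Gk`).  IMPORTS BY NAME, restating nothing.  THEOREMS ONLY; standard axioms.  HONEST SCOPE: [4] Prop. 1.2
enters PROVED (p19 ← `B5Prop12GHolds.prop12_famG_printed`); constants `C_α = 5·max(O(1)(α),0) + 4·O(1)·(1 + e^{δ₀})` ours; `C, δ₀` depend on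
`d, L, a`.  NOT summit progress.  Unit `lit-balaban-p38` (gen 21), 2026-08-22.
-/

noncomputable section

open scoped InnerProductSpace BigOperators Matrix
open Finset

namespace Literature.MathematicalPhysics.QuantumFieldTheory.Balaban1983to89.B6BlockHolderGEV1

open LatticeFieldCalculus B5SectBStatements B5Eq117TorusCarriers B6SectADomainsV1 B6SectAOperatorsV1 B6SectAVectorModelV1 B6SectCOperators
  B6SectCTwoScaleV1 B6SectCTwoScaleV1Lattice B5Eq118OneStroke
open BalabanImbrieJaffe1984to88.BIJ85AxialPropagator411 (BondSpace)
open B4Sect5Torus (IsPseudoDist SumBound)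
open B4TorusKernel.MultiPeriod (torusSupNorm torusSupNorm_nonneg)
open B3TorusRadialSums (supDist_eq_zero_iff)
open B6LowerBound2153Torus (rep)
open B6HjGtOpNormV1 (qpE_whole_eq_zero_iff inner_QE_aE_whole)
open B6GOneLevelV1Bridge (GE_apply_eq_sum_Gk)
open B6BlockDecayCalculus (blockBound_of_cubeSup torusDist_isPseudoDist)
open B6BlockHolderCalculus (holderBound_of_cubeSup holderBound_of_blockBound)
open B6BlockDecayHprimeCovV1 (supDist_cast_eq_torusSupNorm eq_of_torusDist_le_zero)
open B6BlockDecayGradFactorsV1 (Dop_comp_apply)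
open BalabanImbrieJaffe1984to88.BIJ85Ineq722Torus (torusRep torusRep_dS torusRep_dY torusRep_blk mem_cube_blk cutoffHyps_torus supDist_blk_le_one)
open BalabanImbrieJaffe1984to88.BIJ85Ineq722DeltaA (Gk DGk deltaAData)
open BalabanImbrieJaffe1984to88.BIJ85Ineq722ProofPart2 (prop12Hyps_of_ineq110_114)
open BalabanImbrieJaffe1984to88.BIJ85Prop12AllTori (prop12Printed_allTori_allScales)

variable {d L m K : ℕ} {hd : 1 ≤ d + 1} {hL : Odd L ∧ 1 < L} {j : ℕ}

open Classical in
/-- **[4] PROPOSITION 1.2, (1.111) MEMBER `‖ζ∇GJ‖_α`, FOR `D_λG^{(w′)}` AS A PAIR (HÖLDER-IN-THE-OUTPUT) BLOCK BOUND** (`c = L^j`, `w′ = a·n^{d+1}`): there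
is `δ₀ > 0` depending on `d, L, a` only and, for every `0 ≤ α < 1`, a `C_α ≥ 0` (same dependence, and `α`) such that for every volume, `j ≤ m + K`,
direction `λ`, fine bonds `b₁ = ⟨x, ν⟩`, `b₂ = ⟨x′, ν⟩` with `|x − x′|_∞ ≤ n` and unit site `y`,
`Σ_{b₀′ : y(b₀′₋) = y}|(D_λG^{(w′)})(e_{b₀′})_{b₁} − (D_λG^{(w′)})(e_{b₀′})_{b₂}| ≤ C_α·(|x − x′|_∞/n)^α·e^{−δ₀|y(x) − y|_T}` — *"O(1) depending on d and α
(O(1) → ∞ if α → 1)"*, `δ₀` NOT depending on `α`. [cite: Balaban1984PropagatorsI, Prop. 1.2 (1.111) p.35; Balaban1984PropagatorsII, p.246 («They follow from the Proposition 1.2»)] -/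
theorem holderBound_DGE_scaling (d L : ℕ) (hd : 1 ≤ d + 1) (hL : Odd L ∧ 1 < L) {a : ℝ} (ha : 0 < a) :
    ∃ δ : ℝ, 0 < δ ∧ ∀ α : ℝ, 0 ≤ α → α < 1 → ∃ C : ℝ, 0 ≤ C ∧ ∀ (m K j : ℕ)
      (hj' : j ≤ (⟨d + 1, L, m, K, hd, hL⟩ : Params).m + (⟨d + 1, L, m, K, hd, hL⟩ : Params).K) (hc : ((L : ℝ) ^ j) ≠ 0)
      (hw' : (0 : ℝ) < a * ((L : ℝ) ^ j) ^ (d + 1)) (lam : Fin (d + 1))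
      (b₁ b₂ : PBond (⟨d + 1, L, m, K, hd, hL⟩ : Params) 0) (_hdir : b₁.dir = b₂.dir) (_hle : supDist b₁.src b₂.src ≤ L ^ j)
      (y : Site (⟨d + 1, L, m, K, hd, hL⟩ : Params) j),
      ∑ b₀' ∈ univ.filter (fun b₀' : PBond (⟨d + 1, L, m, K, hd, hL⟩ : Params) 0 => iterBlockOf j b₀'.src = y),
          |(((((L : ℝ) ^ j) • (onE (LinearMap.funLeft ℝ ℝ (fun b : PBond (⟨d + 1, L, m, K, hd, hL⟩ : Params) 0 =>
              (⟨b.src.shift lam, b.dir⟩ : PBond (⟨d + 1, L, m, K, hd, hL⟩ : Params) 0))) - LinearMap.id) :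
          BondSpace (⟨d + 1, L, m, K, hd, hL⟩ : Params) →ₗ[ℝ] BondSpace (⟨d + 1, L, m, K, hd, hL⟩ : Params))) ∘ₗ
            GE (Domains.whole (P := (⟨d + 1, L, m, K, hd, hL⟩ : Params)) j hj') hc
              (w := fun _ => a * ((L : ℝ) ^ j) ^ (d + 1)) (fun _ => hw')) (EuclideanSpace.single b₀' (1 : ℝ)) b₁ -
           (((((L : ℝ) ^ j) • (onE (LinearMap.funLeft ℝ ℝ (fun b : PBond (⟨d + 1, L, m, K, hd, hL⟩ : Params) 0 =>
              (⟨b.src.shift lam, b.dir⟩ : PBond (⟨d + 1, L, m, K, hd, hL⟩ : Params) 0))) - LinearMap.id) :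
          BondSpace (⟨d + 1, L, m, K, hd, hL⟩ : Params) →ₗ[ℝ] BondSpace (⟨d + 1, L, m, K, hd, hL⟩ : Params))) ∘ₗ
            GE (Domains.whole (P := (⟨d + 1, L, m, K, hd, hL⟩ : Params)) j hj') hc
              (w := fun _ => a * ((L : ℝ) ^ j) ^ (d + 1)) (fun _ => hw')) (EuclideanSpace.single b₀' (1 : ℝ)) b₂| ≤
        C * (((supDist b₁.src b₂.src : ℕ) : ℝ) / (L : ℝ) ^ j) ^ α *
          Real.exp (-(δ * torusSupNorm (Mk (⟨d + 1, L, m, K, hd, hL⟩ : Params) j)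
            (rep (Mk (⟨d + 1, L, m, K, hd, hL⟩ : Params) j) (iterBlockOf j b₁.src) - rep (Mk (⟨d + 1, L, m, K, hd, hL⟩ : Params) j) y))) := by
  obtain ⟨δ₀, C, Cα, Cε, Cαε, hδ₀, hC, H⟩ := prop12Printed_allTori_allScales (a := a) (d + 1) L ha
  refine ⟨δ₀, hδ₀, fun α hα0 hα1 => ⟨5 * max (Cα α) 0 + 4 * C * (1 + Real.exp δ₀), by positivity, ?_⟩⟩
  intro m K j hj' hc hw' lam b₁ b₂ hdir hle y
  have hL0 : 0 < L := by have := hL.2; omega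
  have hLj : (0 : ℝ) < (L : ℝ) ^ j := by positivity
  have h12 := prop12Hyps_of_ineq110_114 (R := torusRep (⟨d + 1, L, m, K, hd, hL⟩ : Params) j (deltaAData hj' a)) hC.le hδ₀
    (H ⟨((⟨d + 1, L, m, K, hd, hL⟩ : Params), j), rfl, rfl, hj'⟩)
  have hcut := cutoffHyps_torus (P := (⟨d + 1, L, m, K, hd, hL⟩ : Params)) (D := deltaAData hj' a) hj'
  have hρ : IsPseudoDist (fun t t' : Site (⟨d + 1, L, m, K, hd, hL⟩ : Params) j => torusSupNorm (Mk (⟨d + 1, L, m, K, hd, hL⟩ : Params) j)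
      (rep (Mk (⟨d + 1, L, m, K, hd, hL⟩ : Params) j) t - rep (Mk (⟨d + 1, L, m, K, hd, hL⟩ : Params) j) t')) :=
    torusDist_isPseudoDist (Mk (⟨d + 1, L, m, K, hd, hL⟩ : Params) j)
  -- the identification with p09's kernel `DGk` (p22, file 8 §5): `(D_λG x)(i) = (∇G J)(i₋, λ, μ(i))`, `J(x′,μ′) = x(⟨x′,μ′⟩)`
  have hGE : ∀ (x : BondSpace (⟨d + 1, L, m, K, hd, hL⟩ : Params)) (b : PBond (⟨d + 1, L, m, K, hd, hL⟩ : Params) 0),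
      GE (Domains.whole (P := (⟨d + 1, L, m, K, hd, hL⟩ : Params)) j hj') hc (w := fun _ => a * ((L : ℝ) ^ j) ^ (d + 1)) (fun _ => hw') x b =
        ∑ jj : Site (⟨d + 1, L, m, K, hd, hL⟩ : Params) 0 × Fin (d + 1), Gk hj' a (b.src, b.dir) jj * x ⟨jj.1, jj.2⟩ := by
    intro x b
    rw [GE_apply_eq_sum_Gk hj' (Domains.whole (P := (⟨d + 1, L, m, K, hd, hL⟩ : Params)) j hj') (qpE_whole_eq_zero_iff hj')
      (fun _ => hw') ha (inner_QE_aE_whole hj' a) x b]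
    exact (Fintype.sum_equiv (LatticeFieldCalculus.bondEquiv) _ _ fun jj => rfl).symm
  have hD : ∀ (x : BondSpace (⟨d + 1, L, m, K, hd, hL⟩ : Params)) (i : PBond (⟨d + 1, L, m, K, hd, hL⟩ : Params) 0),
      (((((L : ℝ) ^ j) • (onE (LinearMap.funLeft ℝ ℝ (fun b : PBond (⟨d + 1, L, m, K, hd, hL⟩ : Params) 0 =>
        (⟨b.src.shift lam, b.dir⟩ : PBond (⟨d + 1, L, m, K, hd, hL⟩ : Params) 0))) - LinearMap.id) :
          BondSpace (⟨d + 1, L, m, K, hd, hL⟩ : Params) →ₗ[ℝ] BondSpace (⟨d + 1, L, m, K, hd, hL⟩ : Params))) ∘ₗ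
      GE (Domains.whole (P := (⟨d + 1, L, m, K, hd, hL⟩ : Params)) j hj') hc (w := fun _ => a * ((L : ℝ) ^ j) ^ (d + 1)) (fun _ => hw')) x i =
      (DGk hj' a *ᵥ (fun jj : Site (⟨d + 1, L, m, K, hd, hL⟩ : Params) 0 × Fin (d + 1) => x ⟨jj.1, jj.2⟩)) (i.src, lam, i.dir) := by
    intro x i
    rw [Dop_comp_apply, hGE, hGE, Matrix.mulVec, dotProduct, ← Finset.sum_sub_distrib, Finset.mul_sum]
    unfold DGk
    refine Finset.sum_congr rfl fun jj _ => ?_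
    dsimp only
    ring
  -- test vectors supported in one block: the source `J` and its support / norm
  have hJ : ∀ (x : BondSpace (⟨d + 1, L, m, K, hd, hL⟩ : Params)) (y' : Site (⟨d + 1, L, m, K, hd, hL⟩ : Params) j),
      (∀ k : PBond (⟨d + 1, L, m, K, hd, hL⟩ : Params) 0, x k ≠ 0 → iterBlockOf j k.src = y') → (∀ k, |x k| ≤ 1) →
      (∀ jj : Site (⟨d + 1, L, m, K, hd, hL⟩ : Params) 0 × Fin (d + 1), (fun jj => x ⟨jj.1, jj.2⟩) jj ≠ 0 →
          jj.1 ∈ (torusRep (⟨d + 1, L, m, K, hd, hL⟩ : Params) j (deltaAData hj' a)).cube y') ∧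
        ‖(fun jj : Site (⟨d + 1, L, m, K, hd, hL⟩ : Params) 0 × Fin (d + 1) => x ⟨jj.1, jj.2⟩)‖ ≤ 1 := by
    intro x y' hsupp hx
    refine ⟨fun jj hjj => ?_, (pi_norm_le_iff_of_nonneg zero_le_one).2 fun jj => by rw [Real.norm_eq_abs]; exact hx ⟨jj.1, jj.2⟩⟩
    have e : iterBlockOf j jj.1 = y' := hsupp ⟨jj.1, jj.2⟩ hjj
    rw [← e]
    exact mem_cube_blk hj' jj.1
  -- (a) the rows of `D_λG^{(w′)}`: block bound `(C, δ₀)` from (1.110)₁ (p22, file 8 §5)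
  have hrow : ∀ (i : PBond (⟨d + 1, L, m, K, hd, hL⟩ : Params) 0) (y' : Site (⟨d + 1, L, m, K, hd, hL⟩ : Params) j),
      ∑ k ∈ univ.filter (fun k : PBond (⟨d + 1, L, m, K, hd, hL⟩ : Params) 0 => iterBlockOf j k.src = y'),
        |(((((L : ℝ) ^ j) • (onE (LinearMap.funLeft ℝ ℝ (fun b : PBond (⟨d + 1, L, m, K, hd, hL⟩ : Params) 0 =>
          (⟨b.src.shift lam, b.dir⟩ : PBond (⟨d + 1, L, m, K, hd, hL⟩ : Params) 0))) - LinearMap.id) :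
          BondSpace (⟨d + 1, L, m, K, hd, hL⟩ : Params) →ₗ[ℝ] BondSpace (⟨d + 1, L, m, K, hd, hL⟩ : Params))) ∘ₗ
          GE (Domains.whole (P := (⟨d + 1, L, m, K, hd, hL⟩ : Params)) j hj') hc
            (w := fun _ => a * ((L : ℝ) ^ j) ^ (d + 1)) (fun _ => hw')) (EuclideanSpace.single k (1 : ℝ)) i| ≤
        C * Real.exp (-(δ₀ * torusSupNorm (Mk (⟨d + 1, L, m, K, hd, hL⟩ : Params) j)
          (rep (Mk (⟨d + 1, L, m, K, hd, hL⟩ : Params) j) (iterBlockOf j i.src) - rep (Mk (⟨d + 1, L, m, K, hd, hL⟩ : Params) j) y'))) := by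
    intro i y'
    refine blockBound_of_cubeSup (ρ := (fun t t' : Site (⟨d + 1, L, m, K, hd, hL⟩ : Params) j => torusSupNorm (Mk (⟨d + 1, L, m, K, hd, hL⟩ : Params) j)
        (rep (Mk (⟨d + 1, L, m, K, hd, hL⟩ : Params) j) t - rep (Mk (⟨d + 1, L, m, K, hd, hL⟩ : Params) j) t')))
      hρ _ (fun b₀ : PBond (⟨d + 1, L, m, K, hd, hL⟩ : Params) 0 => iterBlockOf j b₀.src)
      (fun b₀ : PBond (⟨d + 1, L, m, K, hd, hL⟩ : Params) 0 => iterBlockOf j b₀.src) le_rfl (fun x X z z' hX hsupp hx i' hi' => ?_) i y'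
    have hiz : iterBlockOf j i'.src = z := eq_of_torusDist_le_zero hi'
    have hsupp' : ∀ k : PBond (⟨d + 1, L, m, K, hd, hL⟩ : Params) 0, x k ≠ 0 → iterBlockOf j k.src = z' :=
      fun k hk => eq_of_torusDist_le_zero (hsupp k hk)
    have hsuppJ : ∀ jj : Site (⟨d + 1, L, m, K, hd, hL⟩ : Params) 0 × Fin (d + 1), (fun jj => x ⟨jj.1, jj.2⟩) jj ≠ 0 →
        jj.1 ∈ (torusRep (⟨d + 1, L, m, K, hd, hL⟩ : Params) j (deltaAData hj' a)).cube z' := by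
      intro jj hjj
      have e : iterBlockOf j jj.1 = z' := hsupp' ⟨jj.1, jj.2⟩ hjj
      rw [← e]
      exact mem_cube_blk hj' jj.1
    have hiin : i'.src ∈ (torusRep (⟨d + 1, L, m, K, hd, hL⟩ : Params) j (deltaAData hj' a)).cube z := by
      rw [← hiz]; exact mem_cube_blk hj' i'.src
    have h := h12.e110_1 _ z z' hsuppJ (i'.src, lam, i'.dir) hiin
    have hJn : ‖(fun jj : Site (⟨d + 1, L, m, K, hd, hL⟩ : Params) 0 × Fin (d + 1) => x ⟨jj.1, jj.2⟩)‖ ≤ X :=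
      (pi_norm_le_iff_of_nonneg hX).2 fun jj => by rw [Real.norm_eq_abs]; exact hx ⟨jj.1, jj.2⟩
    rw [hD]
    refine h.trans ?_
    rw [torusRep_dY, supDist_cast_eq_torusSupNorm]
    exact mul_le_mul_of_nonneg_left hJn (by positivity)
  -- the unit distance of the pair and the two regimes
  set t : ℝ := ((supDist b₁.src b₂.src : ℕ) : ℝ) / (L : ℝ) ^ j with ht
  have ht0 : 0 ≤ t := by positivity
  have ht1 : t ≤ 1 := by rw [ht, div_le_one hLj]; exact_mod_cast hle
  have htα : 0 ≤ t ^ α := Real.rpow_nonneg ht0 α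
  have hdS : (torusRep (⟨d + 1, L, m, K, hd, hL⟩ : Params) j (deltaAData hj' a)).dS b₁.src b₂.src = t := by rw [torusRep_dS]
  have hE0 : 0 ≤ Real.exp (-(δ₀ * torusSupNorm (Mk (⟨d + 1, L, m, K, hd, hL⟩ : Params) j)
      (rep (Mk (⟨d + 1, L, m, K, hd, hL⟩ : Params) j) (iterBlockOf j b₁.src) - rep (Mk (⟨d + 1, L, m, K, hd, hL⟩ : Params) j) y))) :=
    (Real.exp_pos _).le
  have hmax0 : 0 ≤ max (Cα α) 0 := le_max_right _ _
  by_cases h0 : supDist b₁.src b₂.src = 0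
  · -- `b₁ = b₂`: nothing to prove
    have hb : b₁ = b₂ := by
      have hs : b₁.src = b₂.src := (supDist_eq_zero_iff _ _).1 h0
      cases b₁; cases b₂
      simp only at hs hdir
      subst hs; subst hdir; rfl
    subst hb
    simp only [sub_self, abs_zero, Finset.sum_const_zero]
    positivity
  have hpos : 0 < (torusRep (⟨d + 1, L, m, K, hd, hL⟩ : Params) j (deltaAData hj' a)).dS b₁.src b₂.src := by
    rw [hdS, ht]
    exact div_pos (by exact_mod_cast Nat.pos_of_ne_zero h0) hLj
  have hle1 : (torusRep (⟨d + 1, L, m, K, hd, hL⟩ : Params) j (deltaAData hj' a)).dS b₁.src b₂.src ≤ 1 := by rw [hdS]; exact ht1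
  by_cases hsm : (torusRep (⟨d + 1, L, m, K, hd, hL⟩ : Params) j (deltaAData hj' a)).dS b₁.src b₂.src ≤ 1 / 4
  · -- CLOSE PAIRS: (1.111) with the cut-off `ζ` of the pair (`ζ(x) = ζ(x′) = 1`), on test vectors supported in the block `y`
    obtain ⟨ys, ζ, hζsupp, hζ1, hζ2, hζb, hζh, hys⟩ := hcut.cutoff b₁.src b₂.src hsm
    have hys' : ys = iterBlockOf j b₁.src := by
      rw [torusRep_dY, torusRep_blk] at hys
      have h00 : supDist (iterBlockOf j b₁.src) ys = 0 := by exact_mod_cast le_antisymm hys (Nat.cast_nonneg _)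
      exact ((supDist_eq_zero_iff _ _).1 h00).symm
    have hsmall : ∑ b₀' ∈ univ.filter (fun b₀' : PBond (⟨d + 1, L, m, K, hd, hL⟩ : Params) 0 => iterBlockOf j b₀'.src = y),
          |(((((L : ℝ) ^ j) • (onE (LinearMap.funLeft ℝ ℝ (fun b : PBond (⟨d + 1, L, m, K, hd, hL⟩ : Params) 0 =>
              (⟨b.src.shift lam, b.dir⟩ : PBond (⟨d + 1, L, m, K, hd, hL⟩ : Params) 0))) - LinearMap.id) :
          BondSpace (⟨d + 1, L, m, K, hd, hL⟩ : Params) →ₗ[ℝ] BondSpace (⟨d + 1, L, m, K, hd, hL⟩ : Params))) ∘ₗ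
            GE (Domains.whole (P := (⟨d + 1, L, m, K, hd, hL⟩ : Params)) j hj') hc
              (w := fun _ => a * ((L : ℝ) ^ j) ^ (d + 1)) (fun _ => hw')) (EuclideanSpace.single b₀' (1 : ℝ)) b₁ -
           (((((L : ℝ) ^ j) • (onE (LinearMap.funLeft ℝ ℝ (fun b : PBond (⟨d + 1, L, m, K, hd, hL⟩ : Params) 0 =>
              (⟨b.src.shift lam, b.dir⟩ : PBond (⟨d + 1, L, m, K, hd, hL⟩ : Params) 0))) - LinearMap.id) :
          BondSpace (⟨d + 1, L, m, K, hd, hL⟩ : Params) →ₗ[ℝ] BondSpace (⟨d + 1, L, m, K, hd, hL⟩ : Params))) ∘ₗ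
            GE (Domains.whole (P := (⟨d + 1, L, m, K, hd, hL⟩ : Params)) j hj') hc
              (w := fun _ => a * ((L : ℝ) ^ j) ^ (d + 1)) (fun _ => hw')) (EuclideanSpace.single b₀' (1 : ℝ)) b₂| ≤
        5 * max (Cα α) 0 * t ^ α * Real.exp (-(δ₀ * torusSupNorm (Mk (⟨d + 1, L, m, K, hd, hL⟩ : Params) j)
            (rep (Mk (⟨d + 1, L, m, K, hd, hL⟩ : Params) j) (iterBlockOf j b₁.src) - rep (Mk (⟨d + 1, L, m, K, hd, hL⟩ : Params) j) y))) := by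
      refine holderBound_of_cubeSup _ (fun b₀ : PBond (⟨d + 1, L, m, K, hd, hL⟩ : Params) 0 => iterBlockOf j b₀.src) b₁ b₂ y (fun x hsupp hx => ?_)
      obtain ⟨hsuppJ, hJn⟩ := hJ x y hsupp hx
      have h := h12.h111 α _ ζ ys y 4 1 hα0 hα1 (by norm_num) zero_le_one hζsupp hsuppJ (hζh α hα0 hα1) hζb
        (b₁.src, lam, b₁.dir) (b₂.src, lam, b₁.dir) rfl hpos hle1
      rw [hζ1, hζ2, one_mul, one_mul, hys', torusRep_dY, supDist_cast_eq_torusSupNorm, hdS] at h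
      rw [hD, hD, show (b₂.src, lam, b₂.dir) = (b₂.src, lam, b₁.dir) by rw [hdir]]
      refine h.trans ?_
      have h5 : max (Cα α) 0 * Real.exp (-(δ₀ * torusSupNorm (Mk (⟨d + 1, L, m, K, hd, hL⟩ : Params) j)
            (rep (Mk (⟨d + 1, L, m, K, hd, hL⟩ : Params) j) (iterBlockOf j b₁.src) - rep (Mk (⟨d + 1, L, m, K, hd, hL⟩ : Params) j) y))) *
            (4 + 1) * ‖(fun jj : Site (⟨d + 1, L, m, K, hd, hL⟩ : Params) 0 × Fin (d + 1) => x ⟨jj.1, jj.2⟩)‖ * t ^ α ≤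
          max (Cα α) 0 * Real.exp (-(δ₀ * torusSupNorm (Mk (⟨d + 1, L, m, K, hd, hL⟩ : Params) j)
            (rep (Mk (⟨d + 1, L, m, K, hd, hL⟩ : Params) j) (iterBlockOf j b₁.src) - rep (Mk (⟨d + 1, L, m, K, hd, hL⟩ : Params) j) y))) *
            (4 + 1) * 1 * t ^ α :=
        mul_le_mul_of_nonneg_right (mul_le_mul_of_nonneg_left hJn (by positivity)) htα
      refine h5.trans (le_of_eq ?_)
      ring
    refine hsmall.trans ?_
    have : 5 * max (Cα α) 0 ≤ 5 * max (Cα α) 0 + 4 * C * (1 + Real.exp δ₀) := by have := hC.le; nlinarith [Real.exp_pos δ₀]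
    exact mul_le_mul_of_nonneg_right (mul_le_mul_of_nonneg_right this htα) hE0
  · -- FAR PAIRS (`¼ < |x − x′| ≤ 1`): (1.110)₁ at both points, `|x − x′|^{−α} ≤ 4`
    have hs : torusSupNorm (Mk (⟨d + 1, L, m, K, hd, hL⟩ : Params) j)
        (rep (Mk (⟨d + 1, L, m, K, hd, hL⟩ : Params) j) (iterBlockOf j b₁.src) - rep (Mk (⟨d + 1, L, m, K, hd, hL⟩ : Params) j) (iterBlockOf j b₂.src)) ≤ 1 := by
      rw [← supDist_cast_eq_torusSupNorm]
      exact_mod_cast supDist_blk_le_one hj' b₁.src b₂.src hle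
    have hfar := holderBound_of_blockBound (ρ := (fun t t' : Site (⟨d + 1, L, m, K, hd, hL⟩ : Params) j => torusSupNorm (Mk (⟨d + 1, L, m, K, hd, hL⟩ : Params) j)
        (rep (Mk (⟨d + 1, L, m, K, hd, hL⟩ : Params) j) t - rep (Mk (⟨d + 1, L, m, K, hd, hL⟩ : Params) j) t')))
      hρ _ (fun b₀ : PBond (⟨d + 1, L, m, K, hd, hL⟩ : Params) 0 => iterBlockOf j b₀.src)
      (fun b₀ : PBond (⟨d + 1, L, m, K, hd, hL⟩ : Params) 0 => iterBlockOf j b₀.src) b₁ b₂ hC.le hδ₀.le hs hrow y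
    refine hfar.trans ?_
    -- `1 ≤ 4·t^α` since `t > ¼`, `α ≤ 1`... via `t^α ≥ t ≥ ¼`
    have htq : 1 / 4 < t := by rw [← hdS]; exact lt_of_not_ge hsm
    have h4 : (1 : ℝ) ≤ 4 * t ^ α := by
      have h1 : t ≤ t ^ α := B6BlockHolderCalculus.self_le_rpow_of_le_one' ht0 ht1 hα1.le
      linarith
    have key : C * (1 + Real.exp (δ₀ * 1)) ≤ (5 * max (Cα α) 0 + 4 * C * (1 + Real.exp δ₀)) * t ^ α := by
      rw [mul_one]
      have h1 : C * (1 + Real.exp δ₀) * 1 ≤ C * (1 + Real.exp δ₀) * (4 * t ^ α) :=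
        mul_le_mul_of_nonneg_left h4 (by have := hC.le; positivity)
      nlinarith [hmax0, htα, h1]
    exact mul_le_mul_of_nonneg_right key hE0

end Literature.MathematicalPhysics.QuantumFieldTheory.Balaban1983to89.B6BlockHolderGEV1

end
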